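import Literature.Probability.LatticeModels.LayeredPlaneRotatorOnsagerLengthWindow
import Literature.Probability.LatticeModels.LayeredPlaneRotatorUniformDecay
import HarnessLib

/-!
# The closed-form rate law of the Aizenman–Simon–Onsager window of the layered plane rotator:
# `K_χ^{3D}(Δ) ≥ log(1+√2) − √(2Δ)` for every anisotropy `0 < Δ ≤ 1/100`

Topic `Literature/Probability/LatticeModels`, namespace `Literature.Probability.LatticeModels.PlaneRotator`.
Sequel of `LayeredPlaneRotatorOnsagerLengthWindow.lean` (the closed-form window: `0 ≤ Δ`, `0 < K`,
`Δ·K·X(K/2) < 1`, `X = 1 + 8q/(1−q)²`, `q = γ₂(K/2)⁻¹ = e^{K} tanh(K/2)` ⇒ `ofReal K ≤ K_χ^{3D}(Δ)`, the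
susceptibility transition coupling `layeredSusceptibilityCriticalCoupling Δ` of the classical layered XY comparison
model with couplings `(J∥, ΔJ∥)`). There the window `K₀(Δ)` (the root of `Δ·K₀·X(K₀/2) = 1`) stayed implicit and was
evaluated per anisotropy by a rational enclosure of one exponential. This file SOLVES the window in closed form:

* §1 (algebra at the Aizenman–Simon–Onsager point `K₁ = log(1+√2)`, `e^{K₁} = 1 + √2`): with `E = e^{K}`,
  `1 − q = (1 + √2 − E)(E − 1 + √2)/(E + 1)` — the closed form FACTORS at the Onsager point
  (`one_sub_onsagerClosedForm_eq`); with `e^{K₁} − e^{K} ≥ e^{K}(K₁ − K)` and the elementary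
  `16 t(t+2) ≤ 24 t(t+1) ≤ 3√2 (t+1)(t+√2)²` on `t = E − 1 ≥ 1` this gives `8q/(1−q)² ≤ (3√2/2)/(K₁ − K)²` for
  `log 2 ≤ K < K₁` (private lemmas); and `0 < log(1+√2) − √(2Δ)` for `Δ ≤ 1/100` (`rateLaw_pos`);
* §2 **THE RATE LAW** (`ofReal_log_one_add_sqrt_two_sub_sqrt_le_layeredSusceptibilityCriticalCoupling`): for every
  `0 < Δ ≤ 1/100`,

    `ENNReal.ofReal (log(1+√2) − √(2Δ)) ≤ layeredSusceptibilityCriticalCoupling Δ`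

  (at `K = K₁ − √(2Δ)`, `E = e^{K} = (1+√2)e^{−√(2Δ)} ≥ 2`, the window reads
  `Δ·K·X ≤ K·(Δ + 3√2/4) ≤ 0.89·1.0708 < 1`), with the corollaries: every `K ≤ log(1+√2) − √(2Δ)` lies in the stack's
  finite-susceptibility phase; strictly below it the uniform across-layer decay of `LayeredPlaneRotatorUniformDecay.lean`
  holds (`exists_uniform_layer_decay_of_lt_rateLaw` — the body of the cell's K5 trigger); the DEFICIT form
  `ofReal(log(1+√2)) ≤ K_χ^{3D}(Δ) + ofReal(√(2Δ))`; and the TEMPERATURE form — every ordering temperature of the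
  comparison stack with couplings `(J∥, J⊥ = ΔJ∥)`, `Δ ≤ 1/100`, is at most
  `T_χ^{3D}(J∥, ΔJ∥) = J∥/K_χ^{3D}(Δ) ≤ J∥/(log(1+√2) − √(2Δ))` (`layeredSusceptibilityTemperature_le_rateLaw`).

Numbers (NOT asserted in Lean; cell seat's `work/ratelaw.py`): `log(1+√2) − √(2Δ)` = 0.7400 (Δ = 1/100),
0.8314 (1/800), 0.8590 (1/4000), 0.8672 (10⁻⁴), against the per-Δ roots `K₀(Δ)` = 0.7631, 0.8364, 0.8608, 0.8683 of the
implicit window: within 3 %, 0.6 %, 0.2 %, 0.13 %, exact as `Δ → 0` (the sharp constant of the implicit window is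
`√(2 log(1+√2)) = 1.328` in place of `√2`: `q′(K₁) = 2` exactly). The `√Δ` rate is a property of THIS CERTIFIED
ENVELOPE (`X ∼ 2/(K₁ − K)²`: the sup-norm Onsager-length bound has susceptibility exponent 2), not of the model: the
physical crossover of weakly coupled layers is Hikami–Tsuneto's `T_c − T_KT ∝ T_KT/ln²(J∥/J⊥)`
(`LayeredPlaneRotatorLogSquaredLaw.lean`, conditional on a KT envelope), and `K_χ^{3D}(Δ) → K_χ(2) ≥ log(1+√2)`
(`tendsto_layeredSusceptibilityCriticalCoupling_zero`), with `K_χ(2)` itself expected near `1.12` [float].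

Cell use (`pub/hubbard-tc`, MO-S3 ORDER → T_c back-end, seat p2 «2D → 3D ordering lemmas»): ONE row for every material
anisotropy — under the XY dictionary (K5) with a certified stiffness ceiling `ρₑ₀ ≤ C`, `T_c ≤ C/(2(log(1+√2) − √(2Δ)))`
for every `0 < Δ ≤ 1/100` through the socket `XYDictionaryAt.le_div_of_ofReal_le_layeredSusceptibilityCriticalCoupling`
(Observables side), in place of one exponential enclosure per anisotropy.

Presearch (2026-08-28, cell seat): the ingredients are classical in print (Aizenman–Simon 1980; Wu 1966 ∕
Deift–Its–Krasovsky 2013 for Onsager's `γ₂`; Liu–Stanley 1972 for the interlayer mean-field crossover); a closed-form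
`√Δ`-rate lower bound on the stack's transition coupling was not found as a stated theorem (corpus hybrid + vector search,
galaxy «Liu-Stanley|quasi-two-dimensional XY|interlayer coupling T_c»: textbook/MC items only).

## What this is not

No statement about any quantum/Hubbard model; no lower bound on any ordering temperature; no value of `K_χ^{3D}(Δ)`
(a lower bound only, through Aizenman–Simon: nothing here reaches beyond `log(1+√2)`); nothing at `Δ > 1/100`, where the
self-avoiding-walk windows of `LayeredPlaneRotatorFisherWindow.lean` are sharper; the `√Δ` law is the rate of the
certified window, not a claim about the true crossover exponent.
-/

noncomputable section

open scoped ENNReal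

namespace Literature.Probability.LatticeModels

namespace PlaneRotator

/-! ## §1 Algebra at the Aizenman–Simon–Onsager point `e^{K₁} = 1 + √2` -/

section Algebra

/-- `1.414 < √2`. [folklore] -/
private theorem rl_sqrt_two_gt : (1.414 : ℝ) < Real.sqrt 2 := by
  rw [Real.lt_sqrt (by norm_num)]; norm_num

/-- `√2 < 1.4143`. [folklore] -/
private theorem rl_sqrt_two_lt : Real.sqrt 2 < (1.4143 : ℝ) := by
  rw [Real.sqrt_lt' (by norm_num)]; norm_num

/-- `log(1+√2) < 0.89` (`e^{0.89} ≥ e·(1 − 0.11) > 2.4192 > 1 + √2`). [folklore] -/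
private theorem rl_log_one_add_sqrt_two_lt : Real.log (1 + Real.sqrt 2) < (0.89 : ℝ) := by
  rw [Real.log_lt_iff_lt_exp (by positivity)]
  have h1 : (2.7182818283 : ℝ) < Real.exp 1 := Real.exp_one_gt_d9
  have h2 : (-0.11 : ℝ) + 1 ≤ Real.exp (-0.11) := Real.add_one_le_exp _
  have h3 : Real.exp (0.89 : ℝ) = Real.exp 1 * Real.exp (-0.11) := by
    rw [← Real.exp_add]; norm_num
  have h4 := rl_sqrt_two_lt
  have h5 : (2.7182818283 : ℝ) * ((-0.11 : ℝ) + 1) ≤ Real.exp 1 * Real.exp (-0.11) :=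
    mul_le_mul h1.le h2 (by norm_num) (Real.exp_pos 1).le
  rw [h3]
  linarith

/-- `√(2Δ) ≤ 0.1415` for `0 ≤ Δ ≤ 1/100`. [folklore] -/
private theorem rl_sqrt_two_mul_le {Δ : ℝ} (hΔ : Δ ≤ 1 / 100) : Real.sqrt (2 * Δ) ≤ 0.1415 := by
  have h : Real.sqrt (2 * Δ) ≤ Real.sqrt (0.1415 ^ 2) := Real.sqrt_le_sqrt (by nlinarith)
  rwa [Real.sqrt_sq (by norm_num)] at h

/-- `2 ≤ e^{K}` and `e^{K}(1 + √(2Δ)) ≤ 1 + √2` at `K = log(1+√2) − √(2Δ)`, `Δ ≤ 1/100`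
(`e^{log(1+√2)} = 1 + √2`, `e^{−s} ≥ 1 − s`, `e^{s} ≥ 1 + s`, `s = √(2Δ) ≤ 0.1415`). [folklore] -/
private theorem rl_exp_rateLaw_bounds {Δ : ℝ} (hΔ : Δ ≤ 1 / 100) :
    2 ≤ Real.exp (Real.log (1 + Real.sqrt 2) - Real.sqrt (2 * Δ)) ∧
      Real.exp (Real.log (1 + Real.sqrt 2) - Real.sqrt (2 * Δ)) * (1 + Real.sqrt (2 * Δ)) ≤ 1 + Real.sqrt 2 := by
  set K₁ : ℝ := Real.log (1 + Real.sqrt 2) with hK₁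
  set s : ℝ := Real.sqrt (2 * Δ) with hs
  have hr2 := rl_sqrt_two_gt
  have hE₁ : Real.exp K₁ = 1 + Real.sqrt 2 := by rw [hK₁, Real.exp_log (by positivity)]
  have hs0 : 0 ≤ s := Real.sqrt_nonneg _
  have hs_le : s ≤ 0.1415 := rl_sqrt_two_mul_le hΔ
  constructor
  · have hEK : Real.exp (K₁ - s) = (1 + Real.sqrt 2) * Real.exp (-s) := by
      rw [sub_eq_add_neg, Real.exp_add, hE₁]
    rw [hEK]
    have hexp_neg : -s + 1 ≤ Real.exp (-s) := Real.add_one_le_exp _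
    have h1 : (1 + Real.sqrt 2) * (-s + 1) ≤ (1 + Real.sqrt 2) * Real.exp (-s) :=
      mul_le_mul_of_nonneg_left hexp_neg (by positivity)
    nlinarith [mul_nonneg (sub_nonneg.2 hr2.le) (sub_nonneg.2 hs_le)]
  · have h := Real.add_one_le_exp s
    calc Real.exp (K₁ - s) * (1 + s) ≤ Real.exp (K₁ - s) * Real.exp s :=
          mul_le_mul_of_nonneg_left (by linarith) (Real.exp_pos _).le
      _ = Real.exp K₁ := by rw [← Real.exp_add]; congr 1; ring
      _ = 1 + Real.sqrt 2 := hE₁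

/-- **`0 < log(1+√2) − √(2Δ)` for `Δ ≤ 1/100`** (indeed `≥ log 2`: `e^{log(1+√2) − √(2Δ)} ≥ 2`) — the reference
coupling of the rate law is a legitimate (positive) coupling; `log(1+√2) = 2β_c(2)`.
[cite: DeiftItsKrasovsky2013, §2, eq. (26)] -/
theorem rateLaw_pos {Δ : ℝ} (hΔ : Δ ≤ 1 / 100) :
    0 < Real.log (1 + Real.sqrt 2) - Real.sqrt (2 * Δ) := by
  have h1 : (1 : ℝ) < Real.exp (Real.log (1 + Real.sqrt 2) - Real.sqrt (2 * Δ)) := by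
    have := (rl_exp_rateLaw_bounds hΔ).1; linarith
  rwa [Real.one_lt_exp_iff] at h1

/-- `log 2 ≤ log(1+√2) − √(2Δ)` for `Δ ≤ 1/100`. [cite: DeiftItsKrasovsky2013, §2, eq. (26)] -/
theorem log_two_le_rateLaw {Δ : ℝ} (hΔ : Δ ≤ 1 / 100) :
    Real.log 2 ≤ Real.log (1 + Real.sqrt 2) - Real.sqrt (2 * Δ) := by
  rw [Real.log_le_iff_le_exp (by norm_num)]
  exact (rl_exp_rateLaw_bounds hΔ).1

/-- **The closed form factors at the Onsager point**: with `E = e^{K}` (so `q = γ₂(K/2)⁻¹ = E(E−1)/(E+1)`,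
`inv_onsagerGammaTwo_eq_exp`), `1 − q = (1 + √2 − E)(E − 1 + √2)/(E + 1)`; in particular
`q < 1 ⟺ E < 1 + √2 ⟺ K < log(1+√2) = 2β_c(2)`. [cite: DeiftItsKrasovsky2013, §2, eq. (22) and eq. (26)] -/
theorem one_sub_onsagerClosedForm_eq (E : ℝ) (hE : 0 ≤ E) :
    1 - E * (E - 1) / (E + 1) = (1 + Real.sqrt 2 - E) * (E - 1 + Real.sqrt 2) / (E + 1) := by
  have h2 : Real.sqrt 2 ^ 2 = 2 := Real.sq_sqrt (by norm_num)
  have hE1 : (E + 1) ≠ 0 := by positivity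
  have hprod : (1 + Real.sqrt 2 - E) * (E - 1 + Real.sqrt 2) = (E + 1) - E * (E - 1) := by
    linear_combination h2
  rw [hprod, sub_div, div_self hE1]

/-- Core estimate: for `2 ≤ E`, `0 < s` and `E(1 + s) ≤ 1 + √2` (think `E = e^{K}`, `log 2 ≤ K`, `K + s ≤ K₁`),
`8q/(1−q)² ≤ (3√2/2)/s²` for `q = E(E−1)/(E+1)`. Ingredients: `1 + √2 − E ≥ E s` and
`16 t(t+2) ≤ 24 t(t+1) ≤ 3√2 (t+1)(t+√2)²` on `t = E − 1 ≥ 1` (`4√2 t ≤ (t+√2)²`). [folklore] -/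
private theorem rl_eight_mul_closedForm_div_sq_le {E s : ℝ} (hE : 2 ≤ E) (hs : 0 < s)
    (hEs : E * (1 + s) ≤ 1 + Real.sqrt 2) :
    8 * (E * (E - 1) / (E + 1) / (1 - E * (E - 1) / (E + 1)) ^ 2) ≤ 3 * Real.sqrt 2 / 2 / s ^ 2 := by
  have h2 : Real.sqrt 2 ^ 2 = 2 := Real.sq_sqrt (by norm_num)
  have h22 : Real.sqrt 2 * Real.sqrt 2 = 2 := by rw [← sq]; exact h2
  have hr2 := rl_sqrt_two_gt
  have hE0 : 0 < E := by linarith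
  have hE1 : 0 < E + 1 := by linarith
  have hA : E * s ≤ 1 + Real.sqrt 2 - E := by nlinarith
  have hEs0 : 0 < E * s := mul_pos hE0 hs
  have hApos : 0 < 1 + Real.sqrt 2 - E := lt_of_lt_of_le hEs0 hA
  have hBpos : 0 < E - 1 + Real.sqrt 2 := by linarith
  have hAne : 1 + Real.sqrt 2 - E ≠ 0 := hApos.ne'
  have hBne : E - 1 + Real.sqrt 2 ≠ 0 := hBpos.ne'
  have hE1ne : E + 1 ≠ 0 := hE1.ne'
  rw [one_sub_onsagerClosedForm_eq E hE0.le]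
  have hfrac : E * (E - 1) / (E + 1) / ((1 + Real.sqrt 2 - E) * (E - 1 + Real.sqrt 2) / (E + 1)) ^ 2 =
      E * (E - 1) * (E + 1) / ((1 + Real.sqrt 2 - E) ^ 2 * (E - 1 + Real.sqrt 2) ^ 2) := by
    field_simp
  have hD : 0 < (1 + Real.sqrt 2 - E) ^ 2 * (E - 1 + Real.sqrt 2) ^ 2 := by positivity
  rw [hfrac, ← mul_div_assoc, div_le_div_iff₀ hD (by positivity)]
  -- goal: `8 * (E(E−1)(E+1)) * s² ≤ 3√2/2 * ((1+√2−E)² (E−1+√2)²)`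
  have hkey : 16 * ((E - 1) * (E + 1)) ≤ 3 * Real.sqrt 2 * (E * (E - 1 + Real.sqrt 2) ^ 2) := by
    have hh1 : 16 * ((E - 1) * (E + 1)) ≤ 24 * ((E - 1) * E) := by
      nlinarith [mul_nonneg (show (0 : ℝ) ≤ E - 1 by linarith) (show (0 : ℝ) ≤ E - 2 by linarith)]
    have hh2 : 4 * Real.sqrt 2 * (E - 1) ≤ (E - 1 + Real.sqrt 2) ^ 2 := by
      nlinarith [sq_nonneg (E - 1 - Real.sqrt 2)]
    have hh3 : 24 * ((E - 1) * E) ≤ 3 * Real.sqrt 2 * (E * (E - 1 + Real.sqrt 2) ^ 2) := by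
      have h := mul_le_mul_of_nonneg_left hh2 (show (0 : ℝ) ≤ 3 * Real.sqrt 2 * E by positivity)
      have hid : 3 * Real.sqrt 2 * E * (4 * Real.sqrt 2 * (E - 1)) = 24 * ((E - 1) * E) := by
        have : 3 * Real.sqrt 2 * E * (4 * Real.sqrt 2 * (E - 1)) =
            12 * (Real.sqrt 2 * Real.sqrt 2) * ((E - 1) * E) := by ring
        rw [this, h22]; ring
      calc 24 * ((E - 1) * E) = 3 * Real.sqrt 2 * E * (4 * Real.sqrt 2 * (E - 1)) := hid.symm
        _ ≤ 3 * Real.sqrt 2 * E * (E - 1 + Real.sqrt 2) ^ 2 := h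
        _ = 3 * Real.sqrt 2 * (E * (E - 1 + Real.sqrt 2) ^ 2) := by ring
    exact hh1.trans hh3
  have hA2 : E ^ 2 * s ^ 2 ≤ (1 + Real.sqrt 2 - E) ^ 2 := by
    rw [← mul_pow]
    exact pow_le_pow_left₀ hEs0.le hA 2
  calc 8 * (E * (E - 1) * (E + 1)) * s ^ 2 = (E * s ^ 2 / 2) * (16 * ((E - 1) * (E + 1))) := by ring
    _ ≤ (E * s ^ 2 / 2) * (3 * Real.sqrt 2 * (E * (E - 1 + Real.sqrt 2) ^ 2)) :=
        mul_le_mul_of_nonneg_left hkey (by positivity)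
    _ = 3 * Real.sqrt 2 / 2 * ((E ^ 2 * s ^ 2) * (E - 1 + Real.sqrt 2) ^ 2) := by ring
    _ ≤ 3 * Real.sqrt 2 / 2 * ((1 + Real.sqrt 2 - E) ^ 2 * (E - 1 + Real.sqrt 2) ^ 2) := by
        apply mul_le_mul_of_nonneg_left _ (by positivity)
        exact mul_le_mul_of_nonneg_right hA2 (by positivity)

/-- `q = E(E−1)/(E+1) < 1` whenever `0 ≤ E < 1 + √2`. [folklore] -/
private theorem rl_closedForm_lt_one {E : ℝ} (hE : 0 ≤ E) (hE1 : E < 1 + Real.sqrt 2) :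
    E * (E - 1) / (E + 1) < 1 := by
  have h2 : Real.sqrt 2 ^ 2 = 2 := Real.sq_sqrt (by norm_num)
  have hpos : 0 < E + 1 := by linarith
  rw [div_lt_one hpos]
  have hA : 0 < 1 + Real.sqrt 2 - E := by linarith
  have hB : 0 < E - 1 + Real.sqrt 2 := by
    have := rl_sqrt_two_gt; linarith
  nlinarith [mul_pos hA hB]

end Algebra

/-! ## §2 The rate law on `K_χ^{3D}(Δ)` and its faces -/

section RateLaw

open Literature.Barriers.CriticalPhenomena Literature.Barriers.CriticalPhenomena.LongRangeIsing

variable {β Jp : ℝ}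
variable [MeasurableSpace Circle] [BorelSpace Circle]

/-- **THE RATE LAW OF THE AIZENMAN–SIMON–ONSAGER WINDOW**: for every anisotropy `0 < Δ ≤ 1/100`,

  `ENNReal.ofReal (log(1+√2) − √(2Δ)) ≤ layeredSusceptibilityCriticalCoupling Δ`,

i.e. the classical layered XY comparison model with couplings `(J∥, ΔJ∥)` has finite stack susceptibility (hence no
ordering of any kind) at every reduced in-plane coupling `βJ∥ ≤ log(1+√2) − √(2Δ)`: the certified window closes on the
Aizenman–Simon–Onsager point `log(1+√2) = 2β_c(2)` at rate `√(2Δ)`. Proof: the closed-form window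
`ofReal_le_layeredSusceptibilityCriticalCoupling_of_exp_le` at `K = log(1+√2) − s`, `s = √(2Δ) ≤ 0.1415`, with the exact
exponential `E = e^{K}` (`≥ 2`, `E(1+s) ≤ 1+√2`), where §1 gives `Δ·K·(1 + 8q/(1−q)²) ≤ K·(Δ + 3√2/4) ≤ 0.89·1.0708 < 1`.
[cite: LiuStanley1972, p. 272 (interlayer mean-field T_c(ε) of the layers (J, J, εJ))]
[cite: AizenmanSimon1980RotorIsing, eq. (2)]
[cite: Wu1966, T > T_c asymptotics of D_n(φ_Onsager) (= DeiftItsKrasovsky2013 §5 eq. (64))] -/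
theorem ofReal_log_one_add_sqrt_two_sub_sqrt_le_layeredSusceptibilityCriticalCoupling {Δ : ℝ} (hΔ0 : 0 < Δ)
    (hΔ : Δ ≤ 1 / 100) :
    ENNReal.ofReal (Real.log (1 + Real.sqrt 2) - Real.sqrt (2 * Δ)) ≤ layeredSusceptibilityCriticalCoupling Δ := by
  obtain ⟨hE2, hEs⟩ := rl_exp_rateLaw_bounds hΔ
  set K : ℝ := Real.log (1 + Real.sqrt 2) - Real.sqrt (2 * Δ) with hK
  set s : ℝ := Real.sqrt (2 * Δ) with hs
  set E : ℝ := Real.exp K with hE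
  have hr2' := rl_sqrt_two_lt
  have hs0 : 0 < s := Real.sqrt_pos.2 (by positivity)
  have hs2 : s ^ 2 = 2 * Δ := Real.sq_sqrt (by positivity)
  have hK0 : 0 < K := rateLaw_pos hΔ
  have hEpos : 0 < E := Real.exp_pos _
  have hElt : E < 1 + Real.sqrt 2 := by nlinarith [mul_pos hEpos hs0]
  have hq1 : E * (E - 1) / (E + 1) < 1 := rl_closedForm_lt_one hEpos.le hElt
  have hcore := rl_eight_mul_closedForm_div_sq_le hE2 hs0 hEs
  have hKle : K ≤ 0.89 := by
    have h1 := rl_log_one_add_sqrt_two_lt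
    have h2 : K = Real.log (1 + Real.sqrt 2) - s := hK
    linarith
  have hΔne : Δ ≠ 0 := hΔ0.ne'
  have hsne : s ≠ 0 := hs0.ne'
  refine ofReal_le_layeredSusceptibilityCriticalCoupling_of_exp_le hΔ0.le hK0 (le_refl E) hq1 ?_
  have hΔK : 0 ≤ Δ * K := by positivity
  calc Δ * K * (1 + 8 * (E * (E - 1) / (E + 1) / (1 - E * (E - 1) / (E + 1)) ^ 2))
        = Δ * K + Δ * K * (8 * (E * (E - 1) / (E + 1) / (1 - E * (E - 1) / (E + 1)) ^ 2)) := by ring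
    _ ≤ Δ * K + Δ * K * (3 * Real.sqrt 2 / 2 / s ^ 2) :=
        add_le_add_right (mul_le_mul_of_nonneg_left hcore hΔK) (Δ * K)
    _ = K * (Δ + 3 * Real.sqrt 2 / 4) := by rw [hs2]; field_simp; ring
    _ ≤ 0.89 * (1 / 100 + 3 * 1.4143 / 4) :=
        mul_le_mul hKle (by linarith) (by positivity) (by norm_num)
    _ < 1 := by norm_num

/-- **Every `K ≤ log(1+√2) − √(2Δ)` lies in the stack's finite-susceptibility phase** (`0 < Δ ≤ 1/100`):
`ENNReal.ofReal K ≤ K_χ^{3D}(Δ)`. [cite: LiuStanley1972, p. 272] [cite: AizenmanSimon1980RotorIsing, eq. (2)] -/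
theorem ofReal_le_layeredSusceptibilityCriticalCoupling_of_le_rateLaw {Δ K : ℝ} (hΔ0 : 0 < Δ) (hΔ : Δ ≤ 1 / 100)
    (hK : K ≤ Real.log (1 + Real.sqrt 2) - Real.sqrt (2 * Δ)) :
    ENNReal.ofReal K ≤ layeredSusceptibilityCriticalCoupling Δ :=
  (ENNReal.ofReal_le_ofReal hK).trans
    (ofReal_log_one_add_sqrt_two_sub_sqrt_le_layeredSusceptibilityCriticalCoupling hΔ0 hΔ)

/-- **Strict form** (`0 < Δ ≤ 1/100`, `K < log(1+√2) − √(2Δ)` ⇒ `ENNReal.ofReal K < K_χ^{3D}(Δ)`) — the input shape of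
the uniform-decay theorems of `LayeredPlaneRotatorUniformDecay.lean`.
[cite: LiuStanley1972, p. 272] [cite: AizenmanSimon1980RotorIsing, eq. (2)] -/
theorem ofReal_lt_layeredSusceptibilityCriticalCoupling_of_lt_rateLaw {Δ K : ℝ} (hΔ0 : 0 < Δ) (hΔ : Δ ≤ 1 / 100)
    (hK : K < Real.log (1 + Real.sqrt 2) - Real.sqrt (2 * Δ)) :
    ENNReal.ofReal K < layeredSusceptibilityCriticalCoupling Δ :=
  ((ENNReal.ofReal_lt_ofReal_iff (rateLaw_pos hΔ)).2 hK).trans_le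
    (ofReal_log_one_add_sqrt_two_sub_sqrt_le_layeredSusceptibilityCriticalCoupling hΔ0 hΔ)

/-- **Deficit form**: `ofReal(log(1+√2)) ≤ K_χ^{3D}(Δ) + ofReal(√(2Δ))` for `0 < Δ ≤ 1/100` — the stack's susceptibility
transition coupling misses the Aizenman–Simon–Onsager point by at most `√(2Δ)` from below (from above,
`K_χ^{3D}(Δ) ≤ K_χ(2)`, `layeredSusceptibilityCriticalCoupling_le`).
[cite: LiuStanley1972, p. 272] [cite: AizenmanSimon1980RotorIsing, eq. (2)] -/
theorem ofReal_log_one_add_sqrt_two_le_layeredSusceptibilityCriticalCoupling_add {Δ : ℝ} (hΔ0 : 0 < Δ)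
    (hΔ : Δ ≤ 1 / 100) :
    ENNReal.ofReal (Real.log (1 + Real.sqrt 2)) ≤
      layeredSusceptibilityCriticalCoupling Δ + ENNReal.ofReal (Real.sqrt (2 * Δ)) := by
  have h := ofReal_log_one_add_sqrt_two_sub_sqrt_le_layeredSusceptibilityCriticalCoupling hΔ0 hΔ
  have hpos := (rateLaw_pos hΔ).le
  have hs0 : 0 ≤ Real.sqrt (2 * Δ) := Real.sqrt_nonneg _
  calc ENNReal.ofReal (Real.log (1 + Real.sqrt 2))
      = ENNReal.ofReal ((Real.log (1 + Real.sqrt 2) - Real.sqrt (2 * Δ)) + Real.sqrt (2 * Δ)) := by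
        congr 1; ring
    _ = ENNReal.ofReal (Real.log (1 + Real.sqrt 2) - Real.sqrt (2 * Δ)) + ENNReal.ofReal (Real.sqrt (2 * Δ)) :=
        ENNReal.ofReal_add hpos hs0
    _ ≤ layeredSusceptibilityCriticalCoupling Δ + ENNReal.ofReal (Real.sqrt (2 * Δ)) := add_le_add_left h _

/-- **K5-shaped uniform across-layer decay below the rate law**: for `β, J∥ ≥ 0`, `0 < Δ ≤ 1/100` and
`βJ∥ < log(1+√2) − √(2Δ)`, the layered model with couplings `(β; J∥, ΔJ∥)` decays across the layers uniformly in the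
volume — `∃ r ∈ [0,1), ∀ Λ a c, ⟨cos(θ_a − θ_c)⟩_Λ ≤ r^{|ℓ(a) − ℓ(c)|}` (the body of the cell's `LayeredXYDecayAt`).
[cite: Simon1980CMP, Thm 1.3] [cite: LiuStanley1972, p. 272] [cite: AizenmanSimon1980RotorIsing, eq. (2)] -/
theorem exists_uniform_layer_decay_of_lt_rateLaw {Δ : ℝ} (hΔ0 : 0 < Δ) (hΔ : Δ ≤ 1 / 100) (hβ : 0 ≤ β)
    (hp : 0 ≤ Jp) (h : β * Jp < Real.log (1 + Real.sqrt 2) - Real.sqrt (2 * Δ)) :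
    ∃ r : ℝ, 0 ≤ r ∧ r < 1 ∧ ∀ (Λ : Finset (Site 3)) (a c : Λ),
      twoPoint (layeredXYCoupling β Jp (Δ * Jp) Λ) a c ≤ r ^ (layer a - layer c).natAbs :=
  exists_uniform_layer_decay_of_mul_lt_layeredSusceptibilityCriticalCoupling hΔ0.le hβ hp
    (ofReal_lt_layeredSusceptibilityCriticalCoupling_of_lt_rateLaw hΔ0 hΔ h)

/-- **Temperature form**: with the tree's convention `T_χ^{3D}(J∥, ΔJ∥) = J∥/K_χ^{3D}(Δ)`, for `0 < Δ ≤ 1/100`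
`T_χ^{3D}(J∥, ΔJ∥) ≤ J∥/(log(1+√2) − √(2Δ))` — every ordering temperature (susceptibility, long-range order, in-plane or
c-axis stack stiffness) of the comparison stack with `J⊥ = ΔJ∥ ≤ J∥/100` lies below `J∥/(log(1+√2) − √(2 J⊥/J∥))`.
[cite: LiuStanley1972, p. 272 (T_c(ε) → T_c^{2D})] [cite: HikamiTsuneto1980, §4 (contrast: physical rate 1/ln²)]
[cite: AizenmanSimon1980RotorIsing, eq. (2)] -/
theorem layeredSusceptibilityTemperature_le_rateLaw (J : ℝ) {Δ : ℝ} (hΔ0 : 0 < Δ) (hΔ : Δ ≤ 1 / 100) :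
    ENNReal.ofReal J / layeredSusceptibilityCriticalCoupling Δ ≤
      ENNReal.ofReal (J / (Real.log (1 + Real.sqrt 2) - Real.sqrt (2 * Δ))) := by
  have hpos := rateLaw_pos hΔ
  calc ENNReal.ofReal J / layeredSusceptibilityCriticalCoupling Δ
      ≤ ENNReal.ofReal J / ENNReal.ofReal (Real.log (1 + Real.sqrt 2) - Real.sqrt (2 * Δ)) :=
        ENNReal.div_le_div_left
          (ofReal_log_one_add_sqrt_two_sub_sqrt_le_layeredSusceptibilityCriticalCoupling hΔ0 hΔ) _
    _ = ENNReal.ofReal (J / (Real.log (1 + Real.sqrt 2) - Real.sqrt (2 * Δ))) :=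
        (ENNReal.ofReal_div_of_pos hpos).symm

end RateLaw

end PlaneRotator

end Literature.Probability.LatticeModels

end
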